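import Summits.ValiantsHypothesis.ValiantsHypothesis.Theorems.LacunarySymmetroidMatrixDescartesCensusDoorA34Letters
import Summits.ValiantsHypothesis.ValiantsHypothesis.Theorems.LacunarySymmetroidMatrixDescartesCensusFullAlternation
import Summits.ValiantsHypothesis.ValiantsHypothesis.Theorems.LacunarySymmetroidMatrixDescartesCensusSupportNormalForm
import Summits.ValiantsHypothesis.ValiantsHypothesis.Theorems.LacunarySymmetroidMatrixDescartesInertiaParity

/-!
# `MatrixDescartes` census — DOOR A at `(3,4)`: the END-SIGN LAW — a nineteen lives in the ODD CLASS `det S₀ · det S₃ < 0`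

HONEST FRAMING.  Object-search cell `pub-symmetroid`, door-A seat `val-sym-door-p3` (g20); helper beside the OPEN typed
statement `DoorA34 = PosRootLawAt 3 4 18` (route item `Theses.LacunarySymmetroid.DoorA34`, stmt-ValiantsHypothesis-19980,
equal by `Iff.rfl` to `Census.DoorA34`), asserted nowhere in this file.  For ALL supports and with NO symmetry used in the law
itself:

* `three_mul_first_le_of_mem_support` / `le_three_mul_last_of_mem_support` — on a sorted support (`StrictMono d`) every
  exponent of `det (∑ l, X^(d l) • S l)` lies in `[3·d 0, 3·d 3]`;
* **`det_first_mul_det_last_neg_of_nineteen`** — if a `4`-term real `3 × 3` pencil on a sorted support has `19` distinct positive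
  det-roots, then `det (S 0) · det (S 3) < 0`: by the cell's F1 rank-parity row (`Census.pow_neg_one_mul_coeff_mul_coeff_pos_of_sharp`)
  the bottom cube coefficient `det (S 0)` (rank `0`) and the top cube coefficient `det (S 3)` (rank `19`) of a Descartes-sharp
  `20`-nomial have opposite signs (cube coefficients by `Census.coeff_det_pencil_three_mul`, all `20` monomials present by
  `Census.support_det_pencil_eq_of_nineteen`).  Inertia reading: the end letters of a nineteen have negative-index counts of
  DIFFERENT parity (e.g. `(2,1)|(1,2)`, `(3,0)|(2,1)`, …) — the walk `n(x)` makes an odd number (`19`) of unit steps.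
* **`card_posRoots_le_18_of_det_ends_nonneg`** — the EVEN CLASS and the NULL-END classes are Descartes-parity-trivial:
  `StrictMono d`, `0 ≤ det (S 0) · det (S 3)` ⇒ at most `18` distinct positive det-roots (any real letters).
* **`posRootLawAt_three_four_iff_oddClass`** / **`doorA34_iff_oddClass`** — hence `DoorA34` is EQUIVALENT to its restriction to the
  odd class: `∀ d` sorted from `0`, `∀` symmetric letters with `det (S 0) · det (S 3) < 0`, at most `18` roots.
* `neg_one_pow_negIndex_ends_neg_of_nineteen` / **`odd_negIndex_add_negIndex_of_nineteen`** (appended) — the inertia form for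
  symmetric letters: the negative indices of the two end letters of a nineteen have different parity (`Inertia.neg_one_pow_negIndex_mul_det_pos`).
* `doorA34_iff_definiteEnd_and_indefiniteEnds` (appended) — the odd class split by the ends: DoorA34 ⟺ the DEFINITE-END sub-door
  (P2) ∧ the indefinite-ends odd-class residue (both located at `17`).

CENSUS READING (located, report HOME/DOOR-A34-P3G20-REPORT.md §2; decides nothing): the twelve census eighteens are all EVEN class
(end inertias `(1,2)|(1,2)`), where `18` is the parity-sharp Descartes value — so the even class is SETTLED AND SHARP; the forty-five
census seventeens are all ODD class, where the Descartes-parity ceiling is `19` and the located maximum is `17`.  The door is the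
statement «no odd-class nineteen»; nothing here bounds the odd class, `DoorA34` stays OPEN, and nothing bears on `MatrixDescartes`
(stmt-ValiantsHypothesis-18050) or `VP ≠ VNP`.

[folklore] Descartes' rule of signs with parity (rank form); elementary.
-/

-- `Summit.ValiantsHypothesis.ValiantsHypothesis.…` repeats a component by the D-0017 layout
-- (single-conjunct summit), which the `dupNamespace` linter flags; the name is mandated.
set_option linter.dupNamespace false

namespace Summit.ValiantsHypothesis.ValiantsHypothesis.Theorems.LacunarySymmetroidMatrixDescartes.Census

open Polynomial Finset
open scoped BigOperators Polynomial Matrix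
open Summit.ValiantsHypothesis.ValiantsHypothesis.Theorems.MatrixDescartes.Negative (PosRootLawAt)

/-! ## Exponent bounds on a sorted support -/

/-- On a sorted support every exponent of the pencil determinant is at least `3·d 0`. [folklore] -/
theorem three_mul_first_le_of_mem_support (d : Fin 4 → ℕ) (hd : StrictMono d)
    (S : Fin 4 → Matrix (Fin 3) (Fin 3) ℝ) {e : ℕ}
    (he : e ∈ (Matrix.det (∑ l, ((X : ℝ[X]) ^ d l) • (S l).map C)).support) : 3 * d 0 ≤ e := by
  have hsub := StubDescartesCeiling.support_det_pencil_subset d S he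
  obtain ⟨s, -, rfl⟩ := Finset.mem_image.mp hsub
  have hcard : Multiset.card (((s : Multiset (Fin 4)).map d)) = 3 := by
    rw [Multiset.card_map]; exact s.2
  have h := Multiset.card_nsmul_le_sum (s := ((s : Multiset (Fin 4)).map d)) (a := d 0) (fun x hx => by
    obtain ⟨l, -, rfl⟩ := Multiset.mem_map.mp hx
    exact hd.monotone (Fin.zero_le l))
  rw [hcard, smul_eq_mul] at h
  exact h

/-- On a sorted support every exponent of the pencil determinant is at most `3·d 3`. [folklore] -/
theorem le_three_mul_last_of_mem_support (d : Fin 4 → ℕ) (hd : StrictMono d)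
    (S : Fin 4 → Matrix (Fin 3) (Fin 3) ℝ) {e : ℕ}
    (he : e ∈ (Matrix.det (∑ l, ((X : ℝ[X]) ^ d l) • (S l).map C)).support) : e ≤ 3 * d 3 := by
  have hsub := StubDescartesCeiling.support_det_pencil_subset d S he
  obtain ⟨s, -, rfl⟩ := Finset.mem_image.mp hsub
  have hcard : Multiset.card (((s : Multiset (Fin 4)).map d)) = 3 := by
    rw [Multiset.card_map]; exact s.2
  have h := Multiset.sum_le_card_nsmul (((s : Multiset (Fin 4)).map d)) (d 3) (fun x hx => by
    obtain ⟨l, -, rfl⟩ := Multiset.mem_map.mp hx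
    exact hd.monotone (Fin.le_last l))
  rw [hcard, smul_eq_mul] at h
  exact h

/-! ## The end-sign law -/

/-- **END-SIGN LAW.**  If a `4`-term real `3 × 3` pencil on a sorted support (`StrictMono d`) has `19` distinct positive
det-roots, then the end-letter determinants have OPPOSITE signs: `det (S 0) · det (S 3) < 0` (the odd class).  Any real letters;
symmetry is not used. [folklore] -/
theorem det_first_mul_det_last_neg_of_nineteen (d : Fin 4 → ℕ) (hd : StrictMono d)
    (S : Fin 4 → Matrix (Fin 3) (Fin 3) ℝ)
    (h19 : 19 ≤ ((Matrix.det (∑ l, ((X : ℝ[X]) ^ d l) • (S l).map C)).roots.toFinset.filter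
      (fun t => 0 < t)).card) :
    (S 0).det * (S 3).det < 0 := by
  set f : ℝ[X] := Matrix.det (∑ l, ((X : ℝ[X]) ^ d l) • (S l).map C) with hf
  -- the support is the full set of `20` triple sums
  have hsupp := support_det_pencil_eq_of_nineteen d S h19
  have hinj := sym_sum_injective_of_nineteen d S h19
  have hcard : f.support.card = 20 := by
    rw [hf, hsupp, Finset.card_image_of_injective _ hinj, Finset.card_univ, Sym.card_sym_eq_choose]
    decide
  have hZ : f.support.card ≤ (f.roots.toFinset.filter (fun x => 0 < x)).card + 1 := by
    rw [hcard]; omega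
  have hmem0 : 3 * d 0 ∈ f.support := three_mul_mem_support_of_nineteen d S h19 0
  have hmem3 : 3 * d 3 ∈ f.support := three_mul_mem_support_of_nineteen d S h19 3
  have h03 : 3 * d 0 ≤ 3 * d 3 := Nat.mul_le_mul_left 3 (hd.monotone (Fin.zero_le (3 : Fin 4)))
  -- the rank of the top cube exponent above the bottom one is `19`
  have hfilter : f.support.filter (fun c => 3 * d 0 < c ∧ c ≤ 3 * d 3) = f.support.erase (3 * d 0) := by
    ext c
    simp only [Finset.mem_filter, Finset.mem_erase]
    constructor
    · rintro ⟨hc, hlt, -⟩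
      exact ⟨hlt.ne', hc⟩
    · rintro ⟨hne, hc⟩
      exact ⟨hc, lt_of_le_of_ne (three_mul_first_le_of_mem_support d hd S hc) (Ne.symm hne),
        le_three_mul_last_of_mem_support d hd S hc⟩
  have hrank : (f.support.filter (fun c => 3 * d 0 < c ∧ c ≤ 3 * d 3)).card = 19 := by
    rw [hfilter, Finset.card_erase_of_mem hmem0, hcard]
  have key := pow_neg_one_mul_coeff_mul_coeff_pos_of_sharp f hZ 19 hmem0 hmem3 h03 hrank
  have hc0 : f.coeff (3 * d 0) = (S 0).det :=
    coeff_det_pencil_three_mul d S 0 (cube_unique_of_nineteen d S h19 0)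
  have hc3 : f.coeff (3 * d 3) = (S 3).det :=
    coeff_det_pencil_three_mul d S 3 (cube_unique_of_nineteen d S h19 3)
  rw [hc0, hc3] at key
  have hpow : (-1 : ℝ) ^ 19 = -1 := by norm_num
  rw [hpow] at key
  linarith

/-- **The even class and the null-end classes are Descartes-parity-trivial.**  On a sorted support, if
`0 ≤ det (S 0) · det (S 3)` (end determinants of the same sign, or one of them zero), the pencil determinant has at most `18`
distinct positive roots — for ANY real letters. [folklore] -/
theorem card_posRoots_le_18_of_det_ends_nonneg (d : Fin 4 → ℕ) (hd : StrictMono d)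
    (S : Fin 4 → Matrix (Fin 3) (Fin 3) ℝ) (h : 0 ≤ (S 0).det * (S 3).det) :
    ((Matrix.det (∑ l, ((X : ℝ[X]) ^ d l) • (S l).map C)).roots.toFinset.filter
      (fun t => 0 < t)).card ≤ 18 := by
  by_contra h19
  have := det_first_mul_det_last_neg_of_nineteen d hd S (by omega)
  linarith

/-- Row currency, symmetric letters: on a sorted support the door-A bound `≤ 18` holds throughout the closed class
`0 ≤ det (S 0) · det (S 3)`. [folklore] -/
theorem doorA34_on_evenClass (d : Fin 4 → ℕ) (hd : StrictMono d)
    (S : Fin 4 → Matrix (Fin 3) (Fin 3) ℝ) (_hS : ∀ l, (S l).IsSymm) (h : 0 ≤ (S 0).det * (S 3).det) :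
    ((∑ l, (X : ℝ[X]) ^ d l • (S l).map C).det.roots.toFinset.filter (fun t => 0 < t)).card ≤ 18 :=
  card_posRoots_le_18_of_det_ends_nonneg d hd S h

/-! ## The door is the odd class -/

/-- **`PosRootLawAt 3 4 18` ⟺ its ODD-CLASS restriction**: it suffices to bound, on every sorted support starting at `0`,
the symmetric pencils with `det (S 0) · det (S 3) < 0`. [folklore] -/
theorem posRootLawAt_three_four_iff_oddClass :
    PosRootLawAt 3 4 18 ↔
      ∀ d : Fin 4 → ℕ, StrictMono d → d 0 = 0 →
        ∀ S : Fin 4 → Matrix (Fin 3) (Fin 3) ℝ, (∀ l, (S l).IsSymm) → (S 0).det * (S 3).det < 0 →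
          ((∑ l, (X : ℝ[X]) ^ d l • (S l).map C).det.roots.toFinset.filter (fun t => 0 < t)).card ≤ 18 := by
  rw [posRootLawAt_iff_strictMono 3 3 18]
  constructor
  · intro h d hd hd0 S hS _
    exact h d hd hd0 S hS
  · intro h d hd hd0 S hS
    rcases lt_or_ge ((S 0).det * (S 3).det) 0 with hneg | hnonneg
    · exact h d hd hd0 S hS hneg
    · exact card_posRoots_le_18_of_det_ends_nonneg d hd S hnonneg

/-- **`DoorA34` is its odd class**: the cell's standalone target `Census.DoorA34` (`= PosRootLawAt 3 4 18`, equal by `Iff.rfl`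
to the route item `Theses.LacunarySymmetroid.DoorA34`) holds iff every real symmetric `(3,4)` pencil on a sorted support
`0 = d 0 < d 1 < d 2 < d 3` with `det (S 0) · det (S 3) < 0` has at most `18` distinct positive det-roots. [folklore] -/
theorem doorA34_iff_oddClass :
    DoorA34 ↔
      ∀ d : Fin 4 → ℕ, StrictMono d → d 0 = 0 →
        ∀ S : Fin 4 → Matrix (Fin 3) (Fin 3) ℝ, (∀ l, (S l).IsSymm) → (S 0).det * (S 3).det < 0 →
          ((∑ l, (X : ℝ[X]) ^ d l • (S l).map C).det.roots.toFinset.filter (fun t => 0 < t)).card ≤ 18 :=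
  posRootLawAt_three_four_iff_oddClass

/-- Counterexample currency: `DoorA34` FAILS iff some symmetric pencil on a sorted support from `0` with
`det (S 0) · det (S 3) < 0` has at least `19` distinct positive det-roots. [folklore] -/
theorem not_doorA34_iff_oddClass_nineteen :
    ¬ DoorA34 ↔
      ∃ (d : Fin 4 → ℕ) (S : Fin 4 → Matrix (Fin 3) (Fin 3) ℝ), StrictMono d ∧ d 0 = 0 ∧ (∀ l, (S l).IsSymm) ∧
        (S 0).det * (S 3).det < 0 ∧
        19 ≤ ((∑ l, (X : ℝ[X]) ^ d l • (S l).map C).det.roots.toFinset.filter (fun t => 0 < t)).card := by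
  rw [doorA34_iff_oddClass]
  constructor
  · intro h
    simp only [not_forall, not_le] at h
    obtain ⟨d, hd, hd0, S, hS, hneg, hlt⟩ := h
    exact ⟨d, S, hd, hd0, hS, hneg, by omega⟩
  · rintro ⟨d, S, hd, hd0, hS, hneg, h19⟩ h
    have := h d hd hd0 S hS hneg
    omega

/-! ## Inertia form (symmetric letters): the end letters of a nineteen have negative indices of different parity -/

/-- **END-INERTIA LAW.**  For SYMMETRIC letters on a sorted support, a nineteen has end letters `S 0`, `S 3` (both
non-singular, `Census.det_letter_ne_zero_of_nineteen`) whose negative indices `ν` have DIFFERENT PARITY: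
`(−1)^{ν(S 0) + ν(S 3)} < 0` — the inertia walk `n(x)` takes `19` unit steps from `ν(S 0)` at `0⁺` to `ν(S 3)` at `+∞`.  Uses
`Inertia.neg_one_pow_negIndex_mul_det_pos` (`sign det = (−1)^ν`). [folklore] -/
theorem neg_one_pow_negIndex_ends_neg_of_nineteen (d : Fin 4 → ℕ) (hd : StrictMono d)
    (S : Fin 4 → Matrix (Fin 3) (Fin 3) ℝ) (hS : ∀ l, (S l).IsSymm)
    (h19 : 19 ≤ ((Matrix.det (∑ l, ((X : ℝ[X]) ^ d l) • (S l).map C)).roots.toFinset.filter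
      (fun t => 0 < t)).card) :
    (-1 : ℝ) ^ (Fintype.card {j // (Inertia.isHermitian_of_isSymm (hS 0)).eigenvalues j < 0}
        + Fintype.card {j // (Inertia.isHermitian_of_isSymm (hS 3)).eigenvalues j < 0}) < 0 := by
  have hneg := det_first_mul_det_last_neg_of_nineteen d hd S h19
  have h0 := Inertia.neg_one_pow_negIndex_mul_det_pos (Inertia.isHermitian_of_isSymm (hS 0))
    (det_letter_ne_zero_of_nineteen d S h19 0)
  have h3 := Inertia.neg_one_pow_negIndex_mul_det_pos (Inertia.isHermitian_of_isSymm (hS 3))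
    (det_letter_ne_zero_of_nineteen d S h19 3)
  have hprod := mul_pos h0 h3
  rw [pow_add]
  set a := (-1 : ℝ) ^ Fintype.card {j // (Inertia.isHermitian_of_isSymm (hS 0)).eigenvalues j < 0} with ha
  set b := (-1 : ℝ) ^ Fintype.card {j // (Inertia.isHermitian_of_isSymm (hS 3)).eigenvalues j < 0} with hb
  have hab : a * b = 1 ∨ a * b = -1 := by
    rcases neg_one_pow_eq_or ℝ (Fintype.card {j // (Inertia.isHermitian_of_isSymm (hS 0)).eigenvalues j < 0})
      with h | h <;>
    rcases neg_one_pow_eq_or ℝ (Fintype.card {j // (Inertia.isHermitian_of_isSymm (hS 3)).eigenvalues j < 0})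
      with h' | h' <;> simp [ha, hb, h, h']
  have key : 0 < a * b * ((S 0).det * (S 3).det) := by
    have : a * (S 0).det * (b * (S 3).det) = a * b * ((S 0).det * (S 3).det) := by ring
    rw [← this]; exact hprod
  rcases hab with h1 | h1
  · rw [h1, one_mul] at key; linarith
  · rw [h1]; norm_num

/-- The same as a parity statement: `ν(S 0) + ν(S 3)` is ODD for a symmetric nineteen on a sorted support. [folklore] -/
theorem odd_negIndex_add_negIndex_of_nineteen (d : Fin 4 → ℕ) (hd : StrictMono d)
    (S : Fin 4 → Matrix (Fin 3) (Fin 3) ℝ) (hS : ∀ l, (S l).IsSymm)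
    (h19 : 19 ≤ ((Matrix.det (∑ l, ((X : ℝ[X]) ^ d l) • (S l).map C)).roots.toFinset.filter
      (fun t => 0 < t)).card) :
    Odd (Fintype.card {j // (Inertia.isHermitian_of_isSymm (hS 0)).eigenvalues j < 0}
        + Fintype.card {j // (Inertia.isHermitian_of_isSymm (hS 3)).eigenvalues j < 0}) := by
  have h := neg_one_pow_negIndex_ends_neg_of_nineteen d hd S hS h19
  rcases Nat.even_or_odd (Fintype.card {j // (Inertia.isHermitian_of_isSymm (hS 0)).eigenvalues j < 0}
        + Fintype.card {j // (Inertia.isHermitian_of_isSymm (hS 3)).eigenvalues j < 0}) with he | ho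
  · rw [he.neg_one_pow] at h; norm_num at h
  · exact ho

/-! ## The odd class split by the ends: the DEFINITE-END sub-door (P2) and the indefinite-ends residue -/

/-- **`DoorA34` = P2 ∧ (indefinite-ends odd class).**  The door holds iff BOTH (P2) every real symmetric `(3,4)` pencil on a
sorted support from `0` with a DEFINITE END LETTER (`S 0` or `S 3` positive or negative definite) has at most `18` distinct
positive det-roots, AND every such pencil with NO definite end letter and `det (S 0) · det (S 3) < 0` has at most `18`.
Located census values (report DOOR-A34-P3G20 §2, decide nothing): P2 — maximum `17` on `33` rows (walks `(16,1)` ×30, `(14,3)` ×3,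
the definite end entered last); indefinite-ends odd class — maximum `17` on `12` rows (`(17,0)` ×10, `(13,4)`, `(11,6)`).  The smooth
hyperbolic non-symmetroid comparison object of the report realises the P2 walk shape `(18,1)` with `19` roots. [folklore] -/
theorem doorA34_iff_definiteEnd_and_indefiniteEnds :
    DoorA34 ↔
      ((∀ d : Fin 4 → ℕ, StrictMono d → d 0 = 0 →
        ∀ S : Fin 4 → Matrix (Fin 3) (Fin 3) ℝ, (∀ l, (S l).IsSymm) →
          ((S 0).PosDef ∨ (-S 0).PosDef ∨ (S 3).PosDef ∨ (-S 3).PosDef) →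
            ((∑ l, (X : ℝ[X]) ^ d l • (S l).map C).det.roots.toFinset.filter (fun t => 0 < t)).card ≤ 18) ∧
      (∀ d : Fin 4 → ℕ, StrictMono d → d 0 = 0 →
        ∀ S : Fin 4 → Matrix (Fin 3) (Fin 3) ℝ, (∀ l, (S l).IsSymm) →
          ¬ ((S 0).PosDef ∨ (-S 0).PosDef ∨ (S 3).PosDef ∨ (-S 3).PosDef) → (S 0).det * (S 3).det < 0 →
            ((∑ l, (X : ℝ[X]) ^ d l • (S l).map C).det.roots.toFinset.filter (fun t => 0 < t)).card ≤ 18)) := by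
  constructor
  · intro h
    exact ⟨fun d _ _ S hS _ => h d S hS, fun d _ _ S hS _ _ => h d S hS⟩
  · rintro ⟨hP2, hres⟩
    rw [doorA34_iff_oddClass]
    intro d hd hd0 S hS hodd
    by_cases hdef : (S 0).PosDef ∨ (-S 0).PosDef ∨ (S 3).PosDef ∨ (-S 3).PosDef
    · exact hP2 d hd hd0 S hS hdef
    · exact hres d hd hd0 S hS hdef hodd

end Summit.ValiantsHypothesis.ValiantsHypothesis.Theorems.LacunarySymmetroidMatrixDescartes.Census
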